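import Literature.GroupTheory.CombinatorialGroupTheory.AmalgamConjugationTheorem
import Literature.GroupTheory.CombinatorialGroupTheory.AmalgamNormalForm
import Mathlib.GroupTheory.Transfer
import HarnessLib

/-!
# Centralizers in an amalgam with malnormal amalgamated subgroup are cyclic

Topic `Literature/GroupTheory/CombinatorialGroupTheory`; theorems only, concluding the series
`AmalgamReducedWords` / `AmalgamConjugation` / `AmalgamConjugationTheorem` / `AmalgamNormalForm`
on Mathlib's amalgamated product `Monoid.PushoutI φ`.  Hypotheses: the maps `φ i : H → G i` are
injective; the amalgamated subgroup is **malnormal** in every factor (`g ∉ φ i(H)` and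
`g φ i(c) g⁻¹ ∈ φ i(H)` force `c = 1`); centralizers of non-trivial elements are cyclic in `H` and
in every factor; `H` and the factors are torsion free.  Conclusion (Karrass–Solitar, *The subgroups
of a free product of two groups with an amalgamated subgroup*, Trans. AMS 150 (1970), §5, for the
malnormal case; Magnus–Karrass–Solitar §4.2 Cor. 4.5 and Thm. 4.6):

* `isCyclic_centralizer_cr` — the centralizer `Z` of a cyclically reduced element `W` of length
  `≥ 2` is infinite cyclic: by the conjugation theorem every `h ∈ Z` is
  `(base c) · ℓπ (w.drop k) · W ^ q`, and `Z` meets the base group trivially (malnormality), so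
  `⟨W⟩` has index `≤ |w|` in `Z`; since `⟨W⟩` is central in `Z` and `Z` is torsion free, the
  transfer `Z → ⟨W⟩`, `z ↦ z ^ [Z : ⟨W⟩]`, is an injective homomorphism into a cyclic group;
* `isCyclic_centralizer` — **every non-trivial element has cyclic centralizer**;
* `isCyclic_of_forall_commute` — **every abelian subgroup is cyclic**.

Applied in `SurfaceGroupAbelianSubgroups.lean` to `S_g = F_{2g-2} *_ℤ F_2`
([IUTchI] Lemma 2.7 (iv) for orientable surface groups).

## References

* W. Magnus, A. Karrass, D. Solitar, *Combinatorial Group Theory*, Interscience (1966), §4.2,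
  Thm. 4.6, Cor. 4.5. [MagnusKarrassSolitar1966]
* R. C. Lyndon, P. E. Schupp, *Combinatorial Group Theory*, Springer (1977); Classics in
  Mathematics (2001), Ch. IV Thm. 2.8. [LyndonSchupp2001]
-/

namespace Literature.GroupTheory.CombinatorialGroupTheory

namespace Amalgam

open Monoid Monoid.PushoutI

variable {ι : Type*} {G : ι → Type*} [∀ i, Group (G i)] {H : Type*} [Group H]
  {φ : ∀ i, H →* G i}

/-- The value in `PushoutI φ` of a letter list. -/
local notation3 "ℓπ[" φ "] " l:max =>
  List.prod (List.map (fun x => Monoid.PushoutI.of (φ := φ) (Sigma.fst x) (Sigma.snd x)) l)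

/-! ### The centralizer of a cyclically reduced element -/

/-- **Malnormality ⇒ the centralizer of a cyclically reduced element of length `≥ 2` meets the
base group trivially.** [cite: MagnusKarrassSolitar1966, §4.2 Thm. 4.6] -/
theorem base_mem_centralizer_cr (hφ : ∀ i, Function.Injective (φ i))
    (hmal : ∀ (i : ι) (g : G i), g ∉ (φ i).range → ∀ c : H, g * φ i c * g⁻¹ ∈ (φ i).range → c = 1)
    {w : List (Σ i, G i)} (hwc : w.IsChain fun a b => a.1 ≠ b.1)
    (hwr : ∀ x ∈ w, x.2 ∉ (φ x.1).range) (h2 : 2 ≤ w.length) {c : H}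
    (hc : base φ c ∈ Subgroup.centralizer ({ℓπ[φ] w} : Set (PushoutI φ))) : c = 1 := by
  rw [Subgroup.mem_centralizer_singleton_iff] at hc
  obtain ⟨a, u, rfl⟩ := List.exists_cons_of_ne_nil (l := w) (by rintro rfl; simp at h2)
  have hu : u ≠ [] := by rintro rfl; simp at h2
  obtain ⟨u₀, b, rfl⟩ : ∃ u₀ b, u = u₀ ++ [b] := ⟨u.dropLast, u.getLast hu, (List.dropLast_append_getLast hu).symm⟩
  -- `base c · ℓπ w = ℓπ w · base c`, written as two reduced words with first letter in `G a.1`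
  have e1 : base φ c * ℓπ[φ] (a :: (u₀ ++ [b])) = ℓπ[φ] (⟨a.1, φ a.1 c * a.2⟩ :: (u₀ ++ [b])) :=
    base_mul_lprod_cons c a.1 a.2 _
  have e2 : ℓπ[φ] (a :: (u₀ ++ [b])) * base φ c = ℓπ[φ] (⟨a.1, a.2⟩ :: (u₀ ++ [⟨b.1, b.2 * φ b.1 c⟩])) := by
    rw [← List.cons_append, lprod_concat_mul_base, List.cons_append]
  have key := inv_mul_mem_range_of_lprod_cons_eq hφ (i := a.1) (a := φ a.1 c * a.2) (b := a.2)
    (u := u₀ ++ [b]) (u' := u₀ ++ [⟨b.1, b.2 * φ b.1 c⟩]) ?_ ?_ ?_ ?_ 1 ?_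
  · rw [map_one, one_mul] at key
    have ha : a.2 ∉ (φ a.1).range := hwr a List.mem_cons_self
    refine hmal a.1 a.2⁻¹ (inv_not_mem_range ha) c ?_
    simpa [mul_assoc] using key
  · exact isChain_of_map_fst_eq (by simp) hwc
  · intro x hx
    rw [List.mem_cons] at hx
    rcases hx with rfl | hx
    · exact base_mul_not_mem_range (hwr a List.mem_cons_self) c
    · exact hwr x (List.mem_cons_of_mem _ hx)
  · rw [← List.cons_append]
    refine isChain_of_map_fst_eq ?_ hwc
    simp
  · intro x hx
    rw [List.mem_cons, List.mem_append, List.mem_singleton] at hx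
    rcases hx with rfl | hx | rfl
    · exact hwr a List.mem_cons_self
    · exact hwr x (List.mem_cons_of_mem _ (List.mem_append_left _ hx))
    · simpa using mul_not_mem_range (hwr b (by simp)) 1 c
  · rw [map_one, one_mul, ← e1, hc, ← e2]

/-- **Every element of the centralizer of a cyclically reduced `W = ℓπ w` (length `≥ 2`) is
`(base c) · ℓπ (w.drop k) · W ^ q`** with `k < |w|`. [cite: MagnusKarrassSolitar1966, §4.2 Thm. 4.6] -/
theorem exists_eq_of_mem_centralizer_cr (hφ : ∀ i, Function.Injective (φ i))
    {w : List (Σ i, G i)} (hwc : w.IsChain fun a b => a.1 ≠ b.1)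
    (hwr : ∀ x ∈ w, x.2 ∉ (φ x.1).range) (h2 : 2 ≤ w.length)
    (hcr : ∀ x ∈ w.getLast?, ∀ y ∈ w.head?, x.1 ≠ y.1) {h : PushoutI φ}
    (hh : h ∈ Subgroup.centralizer ({ℓπ[φ] w} : Set (PushoutI φ))) :
    ∃ (c : H) (k : ℕ) (q : ℤ), k < w.length ∧ h = base φ c * ℓπ[φ] (w.drop k) * (ℓπ[φ] w) ^ q := by
  rw [Subgroup.mem_centralizer_singleton_iff] at hh
  obtain ⟨c₁, hl, hlc, hlr, rfl⟩ := exists_reduced_eq hφ h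
  have hconj : ℓπ[φ] hl * ℓπ[φ] w * (ℓπ[φ] hl)⁻¹ = base φ c₁⁻¹ * ℓπ[φ] w * (base φ c₁⁻¹)⁻¹ := by
    rw [map_inv, inv_inv]
    calc ℓπ[φ] hl * ℓπ[φ] w * (ℓπ[φ] hl)⁻¹
        = (base φ c₁)⁻¹ * (base φ c₁ * ℓπ[φ] hl * ℓπ[φ] w) * (ℓπ[φ] hl)⁻¹ := by group
      _ = (base φ c₁)⁻¹ * ℓπ[φ] w * base φ c₁ := by rw [hh]; group
  have hY := cr_base_conj (cr_of_word hφ hwc hwr (Or.inr hcr)) c₁⁻¹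
  rw [← hconj] at hY
  obtain ⟨c, k, q, hk, e⟩ :=
    exists_eq_base_mul_drop_mul_zpow hl.length w hl h2 hwc hwr hcr rfl hlc hlr hY
  exact ⟨c₁ * c, k, q, hk, by rw [e, map_mul]; group⟩

/-- **`⟨W⟩` has finite index in the centralizer of a cyclically reduced `W`** (index `≤ |w|`).
[cite: MagnusKarrassSolitar1966, §4.2 Thm. 4.6] -/
theorem finiteIndex_zpowers_centralizer_cr (hφ : ∀ i, Function.Injective (φ i))
    (hmal : ∀ (i : ι) (g : G i), g ∉ (φ i).range → ∀ c : H, g * φ i c * g⁻¹ ∈ (φ i).range → c = 1)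
    {w : List (Σ i, G i)} (hwc : w.IsChain fun a b => a.1 ≠ b.1)
    (hwr : ∀ x ∈ w, x.2 ∉ (φ x.1).range) (h2 : 2 ≤ w.length)
    (hcr : ∀ x ∈ w.getLast?, ∀ y ∈ w.head?, x.1 ≠ y.1)
    (hW : ℓπ[φ] w ∈ Subgroup.centralizer ({ℓπ[φ] w} : Set (PushoutI φ))) :
    (Subgroup.zpowers (⟨ℓπ[φ] w, hW⟩ : Subgroup.centralizer ({ℓπ[φ] w} : Set (PushoutI φ)))).FiniteIndex := by
  classical
  set Z := Subgroup.centralizer ({ℓπ[φ] w} : Set (PushoutI φ)) with hZ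
  set K := Subgroup.zpowers (⟨ℓπ[φ] w, hW⟩ : Z) with hK
  -- a coset representative for each rotation index `k < |w|`
  let P : ℕ → Z → Prop := fun k z =>
    ∃ (c : H) (q : ℤ), (z : PushoutI φ) = base φ c * ℓπ[φ] (w.drop k) * (ℓπ[φ] w) ^ q
  let f : Fin w.length → Z ⧸ K := fun k =>
    if hk : ∃ z, P k z then QuotientGroup.mk hk.choose else QuotientGroup.mk 1
  haveI : Finite (Z ⧸ K) := by
    refine Finite.of_surjective f fun x => ?_
    induction x using QuotientGroup.induction_on with
    | H z =>
      obtain ⟨c, k, q, hk, e⟩ := exists_eq_of_mem_centralizer_cr hφ hwc hwr h2 hcr z.2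
      have hex : ∃ z', P k z' := ⟨z, c, q, e⟩
      refine ⟨⟨k, hk⟩, ?_⟩
      simp only [f, dif_pos hex]
      obtain ⟨c₀, q₀, e₀⟩ := hex.choose_spec
      set z₀ := hex.choose
      -- `(z W^{-q}) (z₀ W^{-q₀})⁻¹ = base (c c₀⁻¹)` lies in `Z`, hence is trivial
      have hmem : base φ (c * c₀⁻¹) ∈ Z := by
        have e3 : base φ (c * c₀⁻¹) =
            ((z : PushoutI φ) * (ℓπ[φ] w) ^ (-q)) * ((z₀ : PushoutI φ) * (ℓπ[φ] w) ^ (-q₀))⁻¹ := by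
          rw [e, e₀, map_mul, map_inv]; group
        rw [e3]
        refine mul_mem (mul_mem z.2 (Subgroup.zpow_mem _ hW _)) (inv_mem (mul_mem z₀.2 (Subgroup.zpow_mem _ hW _)))
      have hcc : c = c₀ := by
        have := base_mem_centralizer_cr hφ hmal hwc hwr h2 hmem
        rwa [mul_inv_eq_one] at this
      rw [QuotientGroup.eq, hK, Subgroup.mem_zpowers_iff]
      refine ⟨q - q₀, Subtype.ext ?_⟩
      simp only [Subgroup.coe_zpow, Subgroup.coe_mul, Subgroup.coe_inv]
      rw [e, e₀, hcc]
      group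
  exact Subgroup.finiteIndex_of_finite_quotient

/-- **The centralizer of a cyclically reduced element of length `≥ 2` is cyclic** (malnormal
amalgamated subgroup, torsion-free data): the transfer to the central finite-index subgroup
`⟨W⟩` is injective. [cite: MagnusKarrassSolitar1966, §4.2 Thm. 4.6] -/
theorem isCyclic_centralizer_cr (hφ : ∀ i, Function.Injective (φ i))
    (hmal : ∀ (i : ι) (g : G i), g ∉ (φ i).range → ∀ c : H, g * φ i c * g⁻¹ ∈ (φ i).range → c = 1)
    [IsMulTorsionFree H] [∀ i, IsMulTorsionFree (G i)]
    {w : List (Σ i, G i)} (hwc : w.IsChain fun a b => a.1 ≠ b.1)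
    (hwr : ∀ x ∈ w, x.2 ∉ (φ x.1).range) (h2 : 2 ≤ w.length)
    (hcr : ∀ x ∈ w.getLast?, ∀ y ∈ w.head?, x.1 ≠ y.1) :
    IsCyclic (Subgroup.centralizer ({ℓπ[φ] w} : Set (PushoutI φ))) := by
  set Z := Subgroup.centralizer ({ℓπ[φ] w} : Set (PushoutI φ)) with hZ
  have hW : ℓπ[φ] w ∈ Z := Subgroup.mem_centralizer_singleton_iff.2 rfl
  set K := Subgroup.zpowers (⟨ℓπ[φ] w, hW⟩ : Z) with hK
  haveI : K.FiniteIndex := finiteIndex_zpowers_centralizer_cr hφ hmal hwc hwr h2 hcr hW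
  -- `K` is central in `Z`
  have hcomm : ∀ (z : Z) (κ : Z), κ ∈ K → z * κ = κ * z := by
    intro z κ hκ
    obtain ⟨n, rfl⟩ := Subgroup.mem_zpowers_iff.1 hκ
    refine Subtype.ext ?_
    simp only [Subgroup.coe_mul, Subgroup.coe_zpow]
    exact (Commute.zpow_right (show Commute (z : PushoutI φ) (ℓπ[φ] w) from
      Subgroup.mem_centralizer_singleton_iff.1 z.2) n).eq
  letI : CommGroup K := IsCyclic.commGroup
  let τ : Z →* K := MonoidHom.transfer (MonoidHom.id K)
  have hτ : ∀ z : Z, ((τ z : K) : Z) = z ^ K.index := by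
    intro z
    have key : ∀ (k : ℕ) (g₀ : Z), g₀⁻¹ * z ^ k * g₀ ∈ K → g₀⁻¹ * z ^ k * g₀ = z ^ k := by
      intro k g₀ hmem
      have hc := hcomm g₀ _ hmem
      symm
      calc z ^ k = g₀ * (g₀⁻¹ * z ^ k * g₀) * g₀⁻¹ := by group
        _ = g₀⁻¹ * z ^ k * g₀ * g₀ * g₀⁻¹ := by rw [hc]
        _ = g₀⁻¹ * z ^ k * g₀ := by group
    have := MonoidHom.transfer_eq_pow (MonoidHom.id K) z key
    rw [this]
    rfl
  have hinj : Function.Injective τ := by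
    rw [← MonoidHom.ker_eq_bot_iff, Subgroup.eq_bot_iff_forall]
    intro z hz
    rw [MonoidHom.mem_ker] at hz
    have h1 : ((z : PushoutI φ)) ^ K.index = 1 := by
      have := hτ z
      rw [hz] at this
      have e : ((z ^ K.index : Z) : PushoutI φ) = 1 := by rw [← this]; rfl
      simpa using e
    exact Subtype.ext (eq_one_of_pow_eq_one hφ Subgroup.FiniteIndex.index_ne_zero h1)
  exact isCyclic_of_injective τ hinj

/-! ### Main theorem -/

/-- **Centralizers of non-trivial elements of the amalgam are cyclic** (injective structure maps,
malnormal amalgamated subgroup, cyclic centralizers in `H` and in the factors, torsion-free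
data). [cite: MagnusKarrassSolitar1966, §4.2 Cor. 4.5] -/
theorem isCyclic_centralizer (hφ : ∀ i, Function.Injective (φ i))
    (hmal : ∀ (i : ι) (g : G i), g ∉ (φ i).range → ∀ c : H, g * φ i c * g⁻¹ ∈ (φ i).range → c = 1)
    (hZ : ∀ (i : ι) (g : G i), g ≠ 1 → IsCyclic (Subgroup.centralizer ({g} : Set (G i))))
    (hZH : ∀ c : H, c ≠ 1 → IsCyclic (Subgroup.centralizer ({c} : Set H)))
    [IsMulTorsionFree H] [∀ i, IsMulTorsionFree (G i)] {x : PushoutI φ} (hx : x ≠ 1) :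
    IsCyclic (Subgroup.centralizer ({x} : Set (PushoutI φ))) := by
  obtain ⟨p, hp⟩ := exists_conj_normalForm hφ x
  have hpx : p * x * p⁻¹ ≠ 1 := by
    intro h; apply hx
    rwa [mul_inv_eq_one, mul_eq_left] at h
  refine isCyclic_centralizer_of_conj p ?_
  rcases hp with ⟨c, hc⟩ | ⟨i, g, hg, hge⟩ | ⟨w, hwc, hwr, h2, hcr, hw⟩
  · rw [hc] at hpx ⊢
    exact isCyclic_centralizer_base hφ hmal hZH (by rintro rfl; exact hpx (map_one _))
  · rw [hge]
    exact isCyclic_centralizer_of hφ hZ hg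
  · rw [hw]
    exact isCyclic_centralizer_cr hφ hmal hwc hwr h2 hcr

/-- **Every abelian subgroup of the amalgam is cyclic** (same hypotheses).
[cite: MagnusKarrassSolitar1966, §4.2 Cor. 4.5] -/
theorem isCyclic_of_forall_commute (hφ : ∀ i, Function.Injective (φ i))
    (hmal : ∀ (i : ι) (g : G i), g ∉ (φ i).range → ∀ c : H, g * φ i c * g⁻¹ ∈ (φ i).range → c = 1)
    (hZ : ∀ (i : ι) (g : G i), g ≠ 1 → IsCyclic (Subgroup.centralizer ({g} : Set (G i))))
    (hZH : ∀ c : H, c ≠ 1 → IsCyclic (Subgroup.centralizer ({c} : Set H)))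
    [IsMulTorsionFree H] [∀ i, IsMulTorsionFree (G i)] (J : Subgroup (PushoutI φ))
    (hJ : ∀ a ∈ J, ∀ b ∈ J, a * b = b * a) : IsCyclic J := by
  by_cases hbot : J = ⊥
  · subst hbot; infer_instance
  · obtain ⟨x, hx1⟩ := (Subgroup.ne_bot_iff_exists_ne_one).1 hbot
    have hle : J ≤ Subgroup.centralizer ({(x : PushoutI φ)} : Set (PushoutI φ)) := fun a ha =>
      Subgroup.mem_centralizer_singleton_iff.2 (hJ a ha x x.2)
    haveI := isCyclic_centralizer hφ hmal hZ hZH (x := (x : PushoutI φ))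
      (fun h => hx1 (Subtype.ext h))
    exact Subgroup.isCyclic_of_le hle

end Amalgam

end Literature.GroupTheory.CombinatorialGroupTheory
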